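import Summits.QuantumFields.BalabanUV.T4Continuum.Spine.NE4.ScaleShiftFrozenHistory
import Summits.QuantumFields.BalabanUV.T4Continuum.Spine.NE4.Targets

/-!
# Spine/NE4/ScaleShiftFrozenData — (R63) ON THE DATA: node U2's input triple `U2Inputs D` from the memory companion of `D.βfun`
# plus the FROZEN-PREFIX comparison with gain θ₀ and ANY finite loss Λ (cell `pub-balaban-gaps`, seat ne4, generation 20; census item
# (R63) of `HOME/ne/NE4.md` §5; β-level half = `Spine/NE4/ScaleShiftFrozenHistory.lean`)

HONEST FRAMING.  Bookkeeping for rung (B)+1 on ONE FIXED finite four-torus — NOT ℝ⁴, NOT infinite volume, NOT a mass gap, NOT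
Clay.  NE4 = `T4CouplingMatching.ScaleShiftRate` is NOT PRINTED ([Balaban1987RG1] p. 264) and NOT PROVED here; spine estimates proved
0∕9, unchanged.  Every hypothesis on `D.βfun` is an UNPRINTED input; nothing of Bałaban's is instantiated or asserted.  0 `def`, 0 sorry.

WHAT.  `Spine/NE4/Targets.U2Inputs D c C θ γ Λ` (:73) is node U2's β-side INPUT TRIPLE on Bałaban's data
`D : T4Continuum.FiniteEpsData` — `ScaleShiftRate c θ γ D.βfun ∧ HistLipschitz Λ γ D.βfun ∧ FadingMemory C θ Λ` (one rate) — from which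
`Targets.u2Output_of_u2Inputs` ∕ `continuumRunning_of_u2Inputs` ∕ `tunedUniqueBelow_of_u2Inputs` deliver node U2's output and its uses BY NAME.
(R63) says the FIRST member need not be supplied as such: given the other two (the memory companion, rate `ω < 1`), the frozen-prefix
comparison `ScaleShiftFrozenHistory.FrozenShift (fun k m ↦ a·Λ^{k+1−m}·θ₀^m) γ D.βfun` with gain `θ₀ < 1` and ANY finite loss `Λ ≥ 0`
already gives the whole triple at some rate `θ′ < 1` (`u2Inputs_of_frozenShift`), hence `NE4OnData D c′ θ′ γ` (`ne4OnData_of_frozenShift`).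
No threshold couples `Λ` to `ω`.  HYPOTHESES ONLY.

No status word moves: NE4 DEPENDENT (⇐ NE5 ∧ (AF-0r)); NOT IN PRINT; NOT PROVED; 0∕9.  HONEST DEPENDENCY (cell, verbatim): continuum
YM on T⁴ ⇐ BetaPertH ∧ nine spine estimates (0∕9 proved); BetaPertH ⇐ (D1) ∧ (D4) ∧ CAP+tail.

References (TYPES only): [Balaban1987RG1] = T. Bałaban, Commun. Math. Phys. **109** (1987) 249–301, (0.20) p. 256, p. 264, §5 p. 298.
-/

noncomputable section

namespace Summit.QuantumFields.BalabanUV.T4Continuum.Spine.NE4.ScaleShiftFrozenData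

open Literature.MathematicalPhysics.QuantumFieldTheory.Balaban1983to89
open Literature.MathematicalPhysics.QuantumFieldTheory.Balaban1983to89.FlowStep
open Literature.MathematicalPhysics.QuantumFieldTheory.Balaban1983to89.T4Continuum
open T4CouplingMatching (ScaleShiftRate HistLipschitz FadingMemory)
open T4BetaReadOut (scaleShiftRate_mono)
open T4FlagMemory (fadingMemory_mono)
open Summit.QuantumFields.BalabanUV.T4Continuum.Spine.NE4.ScaleShiftFrozenHistory (FrozenShift exists_scaleShiftRate_of_frozenShift)

universe u

variable {F : T4Family} {G : Type u} [GaugeGroup G] [MeasurableSpace G] [HaarData G]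

/-- **NODE U2's INPUT TRIPLE ON THE DATA FROM THE COMPANION + THE FROZEN-PREFIX COMPARISON.**  If Bałaban's β-family `D.βfun` has
history moduli `Λ` on the γ-boxes (`HistLipschitz Λ γ D.βfun`) fading at rate `ω ∈ [0,1[` (`FadingMemory C ω Λ`, `C ≥ 0`), and its
frozen-prefix comparison obeys `FrozenShift (fun k m ↦ a·Λ₁^{k+1−m}·θ₀^m) γ D.βfun` with gain `θ₀ ∈ [0,1[` and ANY loss `Λ₁ ≥ 0`
(`a ≥ 0`, `γ > 0`), then for some constant `c′ ≥ 0` and some rate `θ′ ∈ [ω,1[`: `U2Inputs D c′ C θ′ γ Λ` — node U2's whole β-side input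
on the data, at ONE rate.  HYPOTHESES ONLY (all UNPRINTED). [cite: Balaban1987RG1, (0.20) p.256 and §5 p.298] -/
theorem u2Inputs_of_frozenShift (D : FiniteEpsData F G) {Λ : ℕ → ℕ → ℝ} {γ C ω a Λ₁ θ₀ : ℝ}
    (hL : HistLipschitz Λ γ D.βfun) (hΛ : FadingMemory C ω Λ) (hC : 0 ≤ C) (hω0 : 0 ≤ ω) (hω1 : ω < 1) (hγ : 0 < γ)
    (ha : 0 ≤ a) (hΛ₁ : 0 ≤ Λ₁) (hθ0 : 0 ≤ θ₀) (hθ1 : θ₀ < 1)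
    (hF : FrozenShift (fun k m => a * Λ₁ ^ (k + 1 - m) * θ₀ ^ m) γ D.βfun) :
    ∃ c' θ' : ℝ, 0 ≤ c' ∧ ω ≤ θ' ∧ θ' < 1 ∧ U2Inputs D c' C θ' γ Λ := by
  obtain ⟨c', θ₁, hc', hθ₁0, hθ₁1, hS⟩ := exists_scaleShiftRate_of_frozenShift hL hΛ hC hω0 hω1 hγ ha hΛ₁ hθ0 hθ1 hF
  refine ⟨c', max θ₁ ω, hc', le_max_right _ _, max_lt hθ₁1 hω1, ?_, hL, ?_⟩
  · exact scaleShiftRate_mono hc' hθ₁0 (le_max_left _ _) hS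
  · exact fadingMemory_mono hC hω0 (le_max_right _ _) hΛ

/-- **NE4 ON THE DATA** from the same inputs: `∃ c′ ≥ 0, ∃ θ′ ∈ [0,1[, NE4OnData D c′ θ′ γ`. [folklore] -/
theorem ne4OnData_of_frozenShift (D : FiniteEpsData F G) {Λ : ℕ → ℕ → ℝ} {γ C ω a Λ₁ θ₀ : ℝ}
    (hL : HistLipschitz Λ γ D.βfun) (hΛ : FadingMemory C ω Λ) (hC : 0 ≤ C) (hω0 : 0 ≤ ω) (hω1 : ω < 1) (hγ : 0 < γ)
    (ha : 0 ≤ a) (hΛ₁ : 0 ≤ Λ₁) (hθ0 : 0 ≤ θ₀) (hθ1 : θ₀ < 1)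
    (hF : FrozenShift (fun k m => a * Λ₁ ^ (k + 1 - m) * θ₀ ^ m) γ D.βfun) :
    ∃ c' θ' : ℝ, 0 ≤ c' ∧ 0 ≤ θ' ∧ θ' < 1 ∧ NE4OnData D c' θ' γ := by
  obtain ⟨c', θ', hc', hωθ, hθ1', h⟩ := u2Inputs_of_frozenShift D hL hΛ hC hω0 hω1 hγ ha hΛ₁ hθ0 hθ1 hF
  exact ⟨c', θ', hc', hω0.trans hωθ, hθ1', h.ne4⟩

end Summit.QuantumFields.BalabanUV.T4Continuum.Spine.NE4.ScaleShiftFrozenData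

end
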